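import Summits.BirchSwinnertonDyer.Rank1Residual.JET.ZhangKolyvaginPrimeGross
import Literature.NumberTheory.EllipticCurves.HeegnerPointsKolyvaginProp82LocalProofs
import Literature.NumberTheory.EllipticCurves.McCallum1991.KolyvaginClassesLocalLeaves
import HarnessLib

/-!
# Route `KolyvaginDepthDoor`, crux `KolyvaginDepthSupply` (stmt-BirchSwinnertonDyer-21765) —
# LEAF 4 OF THE hF-FREE DOOR AT LEVEL `p`, PROVED: Gross 1991 Prop. 8.1 (1) / McCallum 1991
# Lemma 5.3 in the door's currency — two Selmer `ν`-eigenclasses are DEPENDENT at a Kolyvagin place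

Helper file (`--supports stmt-BirchSwinnertonDyer-21765 --as helper`); it closes nothing and BSD is
not proved by it.

The hF-free door of this route (`…KolyvaginDepthSupplyDoorOfDatum`, via
`exists_hypothesesDepth_of_classes`) consumes, as hypothesis `hcyc` (there fed by the named leaf
`McCallum1991.lemma53_selmer_eigen_dependent_at` at `M = 1`), the statement: *for a Kolyvagin prime
`ℓ` with place `λ`, `e = ±1`, and two classes `s₁, s₂ ∈ Sel_p(E/K)` in the `e`-eigenspace of complex
conjugation, some combination `a s₁ + b s₂` with `(a, b) ≢ (0, 0) (mod p)` vanishes in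
`H¹(K_λ, E_p)`* — McCallum's *"duality of cyclic groups of order `p^M`"* (Lemma 5.3, p. 304) at
`M = 1`, i.e. Gross's *"The eigenspaces `(E(K_λ)/pE(K_λ))^±` … each have dimension `1` over
`ℤ/pℤ`"* (Prop. 8.1 (1), p. 246), read for global classes.

THIS FILE PROVES IT (no named fact), from the tree's §§3, 7–9 material around
`exists_frobeniusLift_of_isKolyvaginPrime` (file `HeegnerPointsKolyvaginProp81FrobeniusProofs`): at
the prime `𝔔 ∣ λ` cut out by the chosen embedding `K̄ → K̄_λ` take the Frobenius lift `t` of `c` and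
`F = Frob(λ)` with `t⁻¹ F t = F`, `F` trivial on `E_p`; a class `s` Selmer at the good place `λ ∤ p`
is unramified at `𝔔` (`selmerLocalKer_eq_unramifiedKer`), so `s_λ = 0 ⟺ [s, F] = 0` (Gross
Prop. 9.6, `mem_torsionLocalKer_iff_h1Eval_eq_zero`), and `[s, F] ∈ E_p^{ν}` for `s` in the
`ν`-eigenspace (`torsionMap_h1Eval_eq_of_conjAct_eq`); `E_p^{ν}` is a LINE
(`KolyvaginEigen.exists_zsmul_of_eigen`: `#E_p = p²`, `t² = 1` with non-zero eigenvectors of both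
signs); hence `[s₂, F] = k [s₁, F]` (or `[s₁, F] = 0`), i.e. `k s₁ − s₂` (or `s₁`) vanishes at `λ`.

* `exists_zsmul_add_zsmul_mem_torsionLocalKer_of_eigen` — the statement at Gross's currency
  (`IsKolyvaginPrime N W K p ℓ`, good reduction of `E/K` at `λ` as a hypothesis), classes in
  `H¹(K, E[p])` Selmer AT `λ` (nothing is required off `λ`).
* `exists_zsmul_add_zsmul_mem_torsionLocalKer_of_eigen_zhang` — the same in the DOOR'S currency:
  Zhang–Kolyvagin prime for `N = N_E` (bridge `JET.ZhangGross.isKolyvaginPrime_of_zhang`, `ρ̄_{E,p}`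
  onto), any finite place `v ∋ ℓ`, classes in `Sel` of `H¹(K, E[q])` for any `q = p` (so that it
  applies verbatim to the door's level `p ^ 1`), good reduction from `ℓ ∤ N_E`.
* `lemma53_selmer_eigen_dependent_at_one` — **the body of the leaf
  `McCallum1991.lemma53_selmer_eigen_dependent_at` at `M = 1`, PROVED** under the leaf's own binders
  (its `¬ CM`, tower and index binders idle beyond `ρ̄_{E,p}` onto).

Scope: level `p` only (the route's doors and rows are all at `c_1(n)`); the level-`p^M` statement
of the leaf needs Gross's (3.2) modulo `p^M`, for which the tree has the Gross → Zhang direction only.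
Nothing is asserted about any curve; BSD is not proved by it.

References: [GrossLMS1991] §3 (3.2), §7 (7.6), §8 Prop. 8.1 (1), §9 Prop. 9.6 (pp. 239, 245–246,
249); [McCallumLMS1991] §5 Lemma 5.3 (p. 304); [WZhang2014] Notations (xii).
-/

set_option linter.dupNamespace false

noncomputable section

open scoped Classical Pointwise

namespace Summit.BirchSwinnertonDyer.BirchSwinnertonDyer.Theorems.KolyvaginDepthDoor

open Literature.NumberTheory.EllipticCurves Literature.NumberTheory.EllipticCurves.ModularForms
  Literature.NumberTheory.GaloisRepresentations WeierstrassCurve NumberField IsDedekindDomain Field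

universe u

section Gross

variable {K : Type u} [Field K] [NumberField K] (W : WeierstrassCurve ℚ)

/-- **Gross 1991 Prop. 8.1 (1) / McCallum 1991 Lemma 5.3 for global classes, PROVED: two Selmer
`ν`-eigenclasses are dependent at a Kolyvagin place.** `K` imaginary quadratic with non-trivial
automorphism `c`, `E = W/ℚ` elliptic, `p` odd, `ℓ` a Kolyvagin prime (Gross (3.1)–(3.2)) with place
`λ = (ℓ)` of good reduction for `E/K`, `ν = ±1`; for `s₁, s₂ ∈ H¹(K, E[p])` satisfying the Selmer
condition at `λ` with `c_* sᵢ = ν sᵢ` there are `a, b ∈ ℤ`, not both divisible by `p`, with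
`a s₁ + b s₂ = 0` in `H¹(K_λ, E[p])` (`torsionLocalKer`). Proof: module docstring (the
`ν`-eigenline of the Frobenius lift of `c` on `E_p` contains both Frobenius values `[sᵢ, Frob λ]`,
and `s_λ = 0 ⟺ [s, Frob λ] = 0` for unramified `s`). [cite: GrossLMS1991, §8 Prop. 8.1 (1), §9 Prop. 9.6]
[cite: McCallumLMS1991, §5 Lemma 5.3] -/
theorem exists_zsmul_add_zsmul_mem_torsionLocalKer_of_eigen {N : ℕ} [W.IsElliptic]
    (hK : IsImaginaryQuadratic K) {p : ℕ} (hp : p.Prime) (hp2 : p ≠ 2)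
    {c : K ≃ₐ[ℚ] K} (hc : c ≠ 1) {ℓ : ℕ} (hℓ : IsKolyvaginPrime N W K p ℓ)
    (hgood : (W.baseChange K).HasGoodReductionAt hℓ.place)
    {ν : ℤ} (hν : ν = 1 ∨ ν = -1)
    {s₁ s₂ : galH1Torsion (W.baseChange K) p}
    (hs₁ : s₁ ∈ selmerLocalKer (W.baseChange K) (hℓ.place.adicCompletion K) p)
    (hτ₁ : conjAct W c p s₁ = ν • s₁)
    (hs₂ : s₂ ∈ selmerLocalKer (W.baseChange K) (hℓ.place.adicCompletion K) p)
    (hτ₂ : conjAct W c p s₂ = ν • s₂) :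
    ∃ a b : ℤ, ¬ ((p : ℤ) ∣ a ∧ (p : ℤ) ∣ b) ∧
      a • s₁ + b • s₂ ∈ (W.baseChange K).torsionLocalKer (hℓ.place.adicCompletion K) p := by
  haveI : Fact p.Prime := ⟨hp⟩
  set v := hℓ.place with hv
  have hp0 : (p : ℤ) ≠ 0 := by exact_mod_cast hp.ne_zero
  have hp1 : ¬ (p : ℤ) ∣ 1 := fun h ↦ hp.one_lt.ne' (by
    have := Int.eq_one_of_dvd_one (Int.natCast_nonneg p) h
    exact_mod_cast this)
  -- `λ` is not bad, `p ∉ λ`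
  have hbad : v ∉ (W.baseChange K).badPlaces (𝓞 K) := by
    rw [WeierstrassCurve.mem_badPlaces_iff, not_not]; exact hgood
  have hpv : ((p : ℤ) : 𝓞 K) ∉ v.asIdeal := by
    rw [Int.cast_natCast]
    exact not_natCast_mem_of_prime_ne hℓ.prime hp hℓ.2.2.2.1 v hℓ.mem_place
  -- the prime `𝔔` cut out by the chosen embedding `K̄ → K̄_λ`
  haveI : CharZero (v.adicCompletion K) :=
    charZero_of_injective_algebraMap (algebraMap K (v.adicCompletion K)).injective
  obtain ⟨𝔐, h𝔐⟩ := v.localPrimesAbove_nonempty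
  set 𝔔 := v.primeBelow (closureEmb (K := K) (v.adicCompletion K)) 𝔐 with h𝔔def
  have h𝔔 : 𝔔 ∈ v.primesAbove := HeightOneSpectrum.primeBelow_mem_primesAbove h𝔐
  -- the Frobenius lift `t` of `c` at `𝔔`, `F = Frob(λ)`, eigenvectors of both signs
  obtain ⟨h, c₀, F, ht, -, -, -, -, hF, -, hFT, hcF, -, ⟨Qp, hQp0, hQp⟩, ⟨Qm, hQm0, hQm⟩, -⟩ :=
    exists_frobeniusLift_of_isKolyvaginPrime W hK hp hp2 hc hℓ h𝔔
  -- the criterion `x_λ = 0 ⟺ [x, F] = 0` for `x` Selmer (hence unramified) at `λ`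
  have hI := inertia_le_torsionFixing (W.baseChange K) hbad hpv
    (closureEmb (K := K) (v.adicCompletion K)) h𝔐
  have hcrit : ∀ {x : galH1Torsion (W.baseChange K) p},
      x ∈ selmerLocalKer (W.baseChange K) (v.adicCompletion K) p →
      (x ∈ (W.baseChange K).torsionLocalKer (v.adicCompletion K) p ↔
        h1Eval (W.baseChange K) p x F = 0) := by
    intro x hx
    have hxunr : x ∈ unramifiedKer (geomTorsion (W.baseChange K) p) 𝔔 := by
      rw [← (W.baseChange K).selmerLocalKer_eq_unramifiedKer hgood hpv h𝔔]
      exact hx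
    exact mem_torsionLocalKer_iff_h1Eval_eq_zero (W.baseChange K) (p : ℤ) h𝔐 hF hFT hI
      (isOpen_torsionFixing (W.baseChange K) hp0)
      (torsionPointsMap_bijective (W.baseChange K) (v.adicCompletion K) hp.ne_zero).2 hxunr
  -- `E_p`: order `p²`, killed by `p`
  have hT : ∀ Q : geomTorsion (W.baseChange K) p, p • Q = 0 := fun Q ↦ by
    have := (mem_geomTorsion_iff (W.baseChange K) p _).mp Q.2
    apply Subtype.ext
    rw [AddSubgroupClass.coe_nsmul, ← natCast_zsmul]
    exact this
  have hcard : Nat.card (geomTorsion (W.baseChange K) p) = p ^ 2 :=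
    card_torsionPoints_eq_sq_holds (W.baseChange K) (AlgebraicClosure K)
      (by exact_mod_cast hp.ne_zero)
  -- the Frobenius values `xᵢ = [sᵢ, F]` are `ν`-eigenvectors of `t`
  have hx₁ := torsionMap_h1Eval_eq_of_conjAct_eq W ht p hFT hcF hτ₁
  have hx₂ := torsionMap_h1Eval_eq_of_conjAct_eq W ht p hFT hcF hτ₂
  by_cases h0 : h1Eval (W.baseChange K) p s₁ F = 0
  · -- `[s₁, F] = 0`: `(a, b) = (1, 0)`
    refine ⟨1, 0, fun hd ↦ hp1 hd.1, ?_⟩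
    rw [one_zsmul, zero_zsmul, add_zero]
    exact (hcrit hs₁).mpr h0
  -- `[s₁, F] ≠ 0` spans the `ν`-eigenline; a non-zero `(-ν)`-eigenvector exists
  have hν' : -ν = 1 ∨ -ν = -1 := by rcases hν with rfl | rfl <;> simp
  obtain ⟨a₀, ha₀0, ha₀⟩ : ∃ a₀ : geomTorsion (W.baseChange K) p, a₀ ≠ 0 ∧
      ht.torsionMap W p a₀ = (-ν) • a₀ := by
    rcases hν with rfl | rfl
    · exact ⟨Qm, hQm0, by rw [hQm, neg_one_zsmul]⟩
    · exact ⟨Qp, hQp0, by rw [hQp, neg_neg, one_zsmul]⟩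
  have hb : ht.torsionMap W p (h1Eval (W.baseChange K) p s₁ F) =
      -((-ν) • h1Eval (W.baseChange K) p s₁ F) := by rw [hx₁, neg_zsmul, neg_neg]
  have hy : ht.torsionMap W p (h1Eval (W.baseChange K) p s₂ F) =
      -((-ν) • h1Eval (W.baseChange K) p s₂ F) := by rw [hx₂, neg_zsmul, neg_neg]
  obtain ⟨k, hk⟩ := KolyvaginEigen.exists_zsmul_of_eigen (ht.torsionMap W p) hp hp2 hT hcard hν'
    ha₀ ha₀0 hb h0 hy
  -- `(a, b) = (k, -1)`: `[k s₁ - s₂, F] = k [s₁, F] - [s₂, F] = 0`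
  refine ⟨k, -1, fun hd ↦ hp1 ((dvd_neg).mp hd.2), ?_⟩
  have hsel : k • s₁ + (-1 : ℤ) • s₂ ∈ selmerLocalKer (W.baseChange K) (v.adicCompletion K) p :=
    AddSubgroup.add_mem _ (AddSubgroup.zsmul_mem _ hs₁ k) (AddSubgroup.zsmul_mem _ hs₂ (-1))
  refine (hcrit hsel).mpr ?_
  rw [h1Eval_add _ _ _ _ hFT, h1Eval_zsmul _ _ _ _ hFT, h1Eval_zsmul _ _ _ _ hFT, hk, neg_one_zsmul,
    add_neg_cancel]

end Gross

section Zhang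

-- `K : Type`: the tree's ring-class / Zhang–Kolyvagin vocabulary is universe `0`.
variable {K : Type} [Field K] [NumberField K] (W : WeierstrassCurve ℚ)

/-- **The same in the door's currency** (`E/ℚ` globally minimal, Zhang–Kolyvagin prime `ℓ` for
`N = N_E`, `ρ̄_{E,p}` onto, ANY finite place `v ∋ ℓ`, classes in `Sel` of `H¹(K, E[q])` for any
`q = p`, both `e`-eigenclasses of `c_*`): some `a s₁ + b s₂`, `(a, b) ≢ (0, 0) (mod p)`, vanishes in
`H¹(K_v, E[q])`. Bridge: `JET.ZhangGross.isKolyvaginPrime_of_zhang` (Zhang ⟹ Gross at odd `p` under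
surjectivity), `IsKolyvaginPrime.mem_iff` (`v = λ`), good reduction at `ℓ ∤ N_E`
(`hasGoodReductionAt_of_isNewformOf_of_not_dvd` over `ℚ` from a modular parametrisation of level
`N_E`, base-changed by `hasGoodReductionAt_baseChange_of_hasGoodReductionAt_rat`).
[cite: GrossLMS1991, §8 Prop. 8.1 (1)] [cite: McCallumLMS1991, §5 Lemma 5.3] [cite: WZhang2014, Notations (xii)] -/
theorem exists_zsmul_add_zsmul_mem_torsionLocalKer_of_eigen_zhang [W.IsElliptic] [W.IsGloballyMinimal]
    [NeZero (W.conductorNorm ℤ)] (Dt : ModularParametrizationData W (W.conductorNorm ℤ))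
    (hK : IsImaginaryQuadratic K) {p : ℕ} [Fact p.Prime] (hp2 : p ≠ 2)
    (hρ : W.HasSurjectiveModNGaloisRep p)
    {c : K ≃ₐ[ℚ] K} (hc : c ≠ 1) {q : ℕ} (hq : q = p)
    {ℓ : ℕ} (hℓ : Zhang2014.IsKolyvaginPrime (W.conductorNorm ℤ) W K p ℓ)
    {e : ℤ} (he : e = 1 ∨ e = -1)
    {s₁ : galH1Torsion (W.baseChange K) (q : ℤ)}
    (hs₁ : s₁ ∈ selmerGroup (W.baseChange K) (q : ℤ)) (hτ₁ : conjAct W c (q : ℤ) s₁ = e • s₁)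
    {s₂ : galH1Torsion (W.baseChange K) (q : ℤ)}
    (hs₂ : s₂ ∈ selmerGroup (W.baseChange K) (q : ℤ)) (hτ₂ : conjAct W c (q : ℤ) s₂ = e • s₂) :
    ∃ a b : ℤ, ¬ ((p : ℤ) ∣ a ∧ (p : ℤ) ∣ b) ∧
      ∀ v : HeightOneSpectrum (𝓞 K), (ℓ : 𝓞 K) ∈ v.asIdeal →
        a • s₁ + b • s₂ ∈ (W.baseChange K).torsionLocalKer (v.adicCompletion K) (q : ℤ) := by
  subst q
  have hp : p.Prime := Fact.out
  have hℓG : IsKolyvaginPrime (W.conductorNorm ℤ) W K p ℓ :=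
    Summit.BirchSwinnertonDyer.Rank1Residual.JET.ZhangGross.isKolyvaginPrime_of_zhang W K hK hp2 hρ hℓ
  -- good reduction of `E/K` at `λ`: `ℓ ∤ N_E` (as in `IsKolyvaginPrime.not_mem_badPlaces`)
  have hgood : (W.baseChange K).HasGoodReductionAt hℓG.place := by
    haveI : hℓG.place.asIdeal.LiesOver (hℓG.place.under (𝓞 ℚ)).asIdeal := ⟨rfl⟩
    exact hasGoodReductionAt_baseChange_of_hasGoodReductionAt_rat W (hℓG.place.under (𝓞 ℚ))
      hℓG.place (hasGoodReductionAt_of_isNewformOf_of_not_dvd W Dt.isNewformOf hℓG.prime hℓG.2.1 _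
        hℓG.natCast_mem_under)
  obtain ⟨a, b, hab, hmem⟩ := exists_zsmul_add_zsmul_mem_torsionLocalKer_of_eigen W hK hp hp2 hc
    hℓG hgood he (((mem_selmerGroup_iff (W.baseChange K) p s₁).mp hs₁).1 _) hτ₁
    (((mem_selmerGroup_iff (W.baseChange K) p s₂).mp hs₂).1 _) hτ₂
  refine ⟨a, b, hab, fun v hv ↦ ?_⟩
  have hveq : v = hℓG.place := hℓG.mem_iff.mp hv
  subst hveq
  exact hmem

/-- **The body of the leaf `McCallum1991.lemma53_selmer_eigen_dependent_at` at `M = 1`, PROVED**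
(its binder list verbatim, specialised to `M = 1`; the `¬ CM`, Heegner-free tower and index binders are
idle beyond `ρ̄_{E,p}` onto = the tower at `n = 1`). A modular parametrisation of level `N_E` exists
for the curves the door treats (it is part of the door's frame); here it is taken as a hypothesis
`Dt` only to read off good reduction at `ℓ ∤ N_E`. [cite: McCallumLMS1991, §5 Lemma 5.3 (p. 304)]
[cite: GrossLMS1991, §8 Prop. 8.1 (1)] -/
theorem lemma53_selmer_eigen_dependent_at_one [W.IsElliptic] [W.IsGloballyMinimal]
    [NeZero (W.conductorNorm ℤ)] (Dt : ModularParametrizationData W (W.conductorNorm ℤ))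
    (hK : IsImaginaryQuadratic K) (p : ℕ) [Fact p.Prime] (hp2 : p ≠ 2)
    (htower : ∀ n : ℕ, W.HasSurjectiveModNGaloisRep (p ^ n : ℕ))
    (c : K ≃ₐ[ℚ] K) (hc : c ≠ 1)
    (ℓ : ℕ) (hℓ : Zhang2014.IsKolyvaginPrime (W.conductorNorm ℤ) W K p ℓ)
    (ν : ℤ) (hν : ν = 1 ∨ ν = -1)
    (s₁ : galH1Torsion (W.baseChange K) ((p ^ 1 : ℕ) : ℤ))
    (hs₁ : s₁ ∈ selmerGroup (W.baseChange K) ((p ^ 1 : ℕ) : ℤ))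
    (hτ₁ : conjAct W c ((p ^ 1 : ℕ) : ℤ) s₁ = ν • s₁)
    (s₂ : galH1Torsion (W.baseChange K) ((p ^ 1 : ℕ) : ℤ))
    (hs₂ : s₂ ∈ selmerGroup (W.baseChange K) ((p ^ 1 : ℕ) : ℤ))
    (hτ₂ : conjAct W c ((p ^ 1 : ℕ) : ℤ) s₂ = ν • s₂) :
    ∃ a b : ℤ, ¬ ((p : ℤ) ∣ a ∧ (p : ℤ) ∣ b) ∧
      ∀ v : HeightOneSpectrum (𝓞 K), (ℓ : 𝓞 K) ∈ v.asIdeal →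
        a • s₁ + b • s₂ ∈ (W.baseChange K).torsionLocalKer (v.adicCompletion K) ((p ^ 1 : ℕ) : ℤ) :=
  exists_zsmul_add_zsmul_mem_torsionLocalKer_of_eigen_zhang W Dt hK hp2
    (by simpa only [pow_one] using htower 1) hc (pow_one p) hℓ hν hs₁ hτ₁ hs₂ hτ₂

end Zhang

end Summit.BirchSwinnertonDyer.BirchSwinnertonDyer.Theorems.KolyvaginDepthDoor

end
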